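import Literature.NumberTheory.EllipticCurves.HeegnerEnvelopeDescentProofs
import Literature.NumberTheory.EllipticCurves.HeegnerGeomStabilizedPointIdentitiesProofs
import HarnessLib

/-!
# The Heegner-module envelope, descent of the stabilised differences at ARBITRARY shift jumps (Lucas pairs):
# `Σ_{i<p} conj_{γ^{p^j i}} D_{j+1} = α^{n_j+1} · D_j` (CGLS 2022 Rem. 4.1.4; proofs file)

Topic `NumberTheory/EllipticCurves`. THEOREMS ONLY (no definition, no named fact, no `sorry`); sequel of
`HeegnerEnvelopeDescentProofs` (the case of consecutive shifts `d(j+1) = d(j) + 1`). Written by the cell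
`bsd-print-x9` seat `bsd-line-x9-p2` for the stub `stub_envelopeTied` of crux stmt-BirchSwinnertonDyer-26359
`PrintX9.HowardContainmentLightFramePinnedOfPrint` and its rev-27 successor.

WHY. In the kernel the shift `d(k)` of a `StabilizedHeegnerData` is pinned to `k − δ + 1` only under the second
clause of the sharpened tower binder (seat x9-p1, `HeegnerGeomShiftPinningProofs`); under the first clause alone one
only knows `d(j+1) ≥ d(j) + 1` (seat x9-p1-w2, `HeegnerGeomLayerDescentProofs`), and the coherent data then satisfy
the GENERALISED point identities with an integer Lucas pair `(A, B)` (`A₀ = 1, A₁ = a_p`, `B₀ = 0, B₁ = −1`,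
`X_{m+2} = a_p X_{m+1} − p X_m`) and jumps `n_j = d(j+1) − 1 − d(j) ≥ 0`
(`HeegnerGeomStabilizedPointIdentitiesProofs`, (P1′)/(P1″)/(P2′)):
* (P1′) `v_{j+1} = A_{n_j} • u_j + B_{n_j} • v_j`,  (P1″) `v_{j+1}` is fixed by `Gal(K̄/K_j)`,
* (P2′) `Σ_{i<p} γ^{p^j i} • u_{j+1} = A_{n_j+1} • u_j + B_{n_j+1} • v_j`.
With `β = p·α⁻¹` one has `A_{n+1} − βA_n = α^{n+1}`, `B_{n+1} − βB_n = −α^n` (`int_lucas_succ_sub_mul_eq_pow`,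
x9-p1-w2), so the descent of `HeegnerEnvelopeDescentProofs` goes through with `α` replaced by the UNIT `α^{n_j+1}`.

WHAT.
* §1 `unitRoot_add_ringInverse_mul`, `unitRoot_mul_ringInverse_mul` — `α + α⁻¹p = a_p`, `α·(α⁻¹p) = p`.
* §2 `sum_conjPi_kummer_v_succ_eq_lucas`, `sum_conjPi_kummer_u_succ_eq_lucas`, and the ONE-STEP DESCENT
  `sum_conjPi_kummerDiff_eq_unitRoot_pow_succ_smul`: `Σ_{i<p} conj_{γ^{p^j i}} D_{j+1} = α^{n_j+1} · D_j`.
* §3 `kummerDiff_mem_stabilizedModuleLayer_lucas[_of_le]` — `D_j ∈ ℤ_p[G_k]·κ_k` for `δ < j ≤ k`.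
* §4 `exists_sum_conjPi_kummerDiff_eq_unitRoot_pow_smul` — `Σ_{i<pⁿ} conj_{γ^{p^k i}} D_{k+n} = α^m · D_k` for
  some `m` (`k > δ`, `k + n ≤ ℓ`).
HONEST FRAMING: Kummer-theoretic bookkeeping of printed distribution relations; nothing about any particular
curve; BSD is not proved by any of this.

References: [CastellaGrossiLeeSkinner2022] Thm. 4.1.1 proof (`d(k)`, `P_k[n]`) and Rem. 4.1.4 (`κ_k` norm-compatible),
arXiv:2008.02571v2 TeX L2213–2294; [Howard2004HeegnerKolyvagin] §3.3; [PerrinRiou1987BSMF] §3.3 Lemme 1–Cor. 5;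
[MazurTateTeitelbaum1986Invent] §I.11 (unit root).
-/

set_option autoImplicit false

noncomputable section

open scoped Classical

open WeierstrassCurve Literature.NumberTheory.EllipticCurves
  Literature.NumberTheory.EllipticCurves.CastellaGrossiLeeSkinner2022 PowerSeries

universe u

namespace Literature.NumberTheory.EllipticCurves

/-! ## §1 The unit root and its co-root `β = p·α⁻¹` -/

section UnitRoot

variable (W : WeierstrassCurve ℚ) [W.IsGloballyMinimal] (p : ℕ) [Fact p.Prime]

/-- `α + α⁻¹·p = a_p` in `ℤ_p` (the two roots of `X² − a_pX + p` sum to `a_p`).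
[cite: MazurTateTeitelbaum1986Invent, §I.11 (allowable root)] -/
theorem unitRoot_add_ringInverse_mul (hord : IsOrdinaryAt W p) :
    unitRoot W p + Ring.inverse (unitRoot W p) * (p : ℤ_[p]) = ((W.frobeniusTrace p : ℤ) : ℤ_[p]) := by
  have h := frobeniusTrace_sub_ringInverse_unitRoot_mul W p hord
  linear_combination (-1 : ℤ_[p]) * h

/-- `α · (α⁻¹·p) = p` in `ℤ_p`. [cite: MazurTateTeitelbaum1986Invent, §I.11 (allowable root)] -/
theorem unitRoot_mul_ringInverse_mul (hord : IsOrdinaryAt W p) :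
    unitRoot W p * (Ring.inverse (unitRoot W p) * (p : ℤ_[p])) = ((p : ℕ) : ℤ_[p]) := by
  rw [← mul_assoc, Ring.mul_inverse_cancel _ (unitRoot_spec_holds W p hord).2, one_mul]

end UnitRoot

/-! ## §2 The one-step descent at a shift jump `n` -/

section LinComb

/-- Linear-combination bookkeeping for the `ℤ_p`-action: `(a'•x + b'•y) − c·(q•(a•x + b•y)) =
(a' − c q a)·x + (b' − c q b)·y`. [cite: PerrinRiou1987BSMF, §0 p. 401 (the ℤ_p-module structure of S_p(L))] -/
theorem _root_.WeierstrassCurve.zsmul_add_zsmul_sub_padicPi_zsmul {K : Type u} [Field K] (V : WeierstrassCurve K)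
    (p : ℕ) [Fact p.Prime] (H : Subgroup (Field.absoluteGaloisGroup K)) (a b a' b' q : ℤ) (c : ℤ_[p])
    (x y : V.torsionH1Pi p H) :
    (a' • x + b' • y) - V.padicPi p H c (q • (a • x + b • y)) =
      V.padicPi p H ((a' : ℤ_[p]) - c * (q : ℤ_[p]) * (a : ℤ_[p])) x +
        V.padicPi p H ((b' : ℤ_[p]) - c * (q : ℤ_[p]) * (b : ℤ_[p])) y := by
  simp only [← padicPi_intCast, map_add, padicPi_padicPi, padicPi_sub_left, ← mul_assoc]
  abel

end LinComb

section Descent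

variable {N : ℕ} [NeZero N] {W : WeierstrassCurve ℚ} [W.IsGloballyMinimal] [W.IsElliptic] {K : Type u}
  [Field K] [NumberField K] {p : ℕ} [Fact p.Prime] {κ : ZpExtension K p} {γ : Field.absoluteGaloisGroup K}
  {jbar : AlgebraicClosure K →+* ℂ} (C : StabilizedHeegnerData N W K κ jbar)

omit [W.IsGloballyMinimal] in
/-- **Norm of the Kummer family of `v_{j+1}` at a jump** (P1′)+(P1″): over any layer `K_ℓ`,
`Σ_{i<p} conj_{γ^{p^j i}} δ(v_{j+1}) = p • (a • δ(u_j) + b • δ(v_j))` when `v_{j+1} = a • u_j + b • v_j` is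
`K_j`-rational. [cite: CastellaGrossiLeeSkinner2022, Thm. 4.1.1 proof (P_k[n]) and Rem. 4.1.4] -/
theorem sum_conjPi_kummer_v_succ_eq_lucas (hγ : κ.IsTopGenerator γ) {j ℓ : ℕ}
    (hjℓ : κ.layerSubgroup ℓ ≤ κ.layerSubgroup j) {a b : ℤ} (hv1 : C.v (j + 1) = a • C.u j + b • C.v j)
    (hvfix : ∀ σ ∈ κ.layerSubgroup j, σ • C.v (j + 1) = C.v (j + 1))
    {hv' : ∀ σ ∈ κ.layerSubgroup ℓ, σ • C.v (j + 1) = C.v (j + 1)}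
    {hu : ∀ σ ∈ κ.layerSubgroup ℓ, σ • C.u j = C.u j} {hv : ∀ σ ∈ κ.layerSubgroup ℓ, σ • C.v j = C.v j}
    {dv' du dv : (W.baseChange K).torsionH1Pi p (κ.layerSubgroup ℓ)}
    (hdv' : (W.baseChange K).IsKummerFamilyOver p (κ.layerSubgroup ℓ) hv' dv')
    (hdu : (W.baseChange K).IsKummerFamilyOver p (κ.layerSubgroup ℓ) hu du)
    (hdv : (W.baseChange K).IsKummerFamilyOver p (κ.layerSubgroup ℓ) hv dv) :
    ∑ i ∈ Finset.range p, (W.baseChange K).conjPi p (κ.layerSubgroup ℓ) (γ ^ (p ^ j * i)) dv' =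
      (p : ℤ) • (a • du + b • dv) := by
  have hcomb := IsKummerFamilyOver.add p (IsKummerFamilyOver.zsmul hdu a) (IsKummerFamilyOver.zsmul hdv b)
  have heq : dv' = a • du + b • dv := IsKummerFamilyOver.unique p hdv' (IsKummerFamilyOver.of_eq hv1.symm hcomb)
  have h := (W.baseChange K).sum_conjPi_eq_pow_smul_of_isKummerFamilyOver p κ hγ (n := 1) hjℓ hvfix hdv'
  rw [pow_one, pow_one] at h
  rw [h, heq]

omit [W.IsGloballyMinimal] in
/-- **Norm of the Kummer family of `u_{j+1}` at a jump** (P2′): over any layer `K_ℓ`,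
`Σ_{i<p} conj_{γ^{p^j i}} δ(u_{j+1}) = a' • δ(u_j) + b' • δ(v_j)` when `Σ_{i<p} γ^{p^j i} • u_{j+1} = a' • u_j + b' • v_j`.
[cite: Howard2004HeegnerKolyvagin, §3.3 (norm relations)] [cite: PerrinRiou1987BSMF, §3.3 Lemme 1] -/
theorem sum_conjPi_kummer_u_succ_eq_lucas {j ℓ : ℕ} {a' b' : ℤ}
    (hnorm : ∑ i ∈ Finset.range p, (γ ^ (p ^ j * i)) • C.u (j + 1) = a' • C.u j + b' • C.v j)
    {hu' : ∀ σ ∈ κ.layerSubgroup ℓ, σ • C.u (j + 1) = C.u (j + 1)}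
    {hu : ∀ σ ∈ κ.layerSubgroup ℓ, σ • C.u j = C.u j} {hv : ∀ σ ∈ κ.layerSubgroup ℓ, σ • C.v j = C.v j}
    {du' du dv : (W.baseChange K).torsionH1Pi p (κ.layerSubgroup ℓ)}
    (hdu' : (W.baseChange K).IsKummerFamilyOver p (κ.layerSubgroup ℓ) hu' du')
    (hdu : (W.baseChange K).IsKummerFamilyOver p (κ.layerSubgroup ℓ) hu du)
    (hdv : (W.baseChange K).IsKummerFamilyOver p (κ.layerSubgroup ℓ) hv dv) :
    ∑ i ∈ Finset.range p, (W.baseChange K).conjPi p (κ.layerSubgroup ℓ) (γ ^ (p ^ j * i)) du' =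
      a' • du + b' • dv := by
  have hsum := IsKummerFamilyOver.sum (p := p) (Finset.range p)
    (fun i ↦ IsKummerFamilyOver.conjPi (γ ^ (p ^ j * i)) hdu')
  have hrhs := IsKummerFamilyOver.add p (IsKummerFamilyOver.zsmul hdu a') (IsKummerFamilyOver.zsmul hdv b')
  exact IsKummerFamilyOver.unique p (IsKummerFamilyOver.of_eq hnorm hsum) hrhs

/-- **ONE-STEP DESCENT at a jump `n`**: over any layer `K_ℓ` containing `K_{j+1}` (`j > δ`), with
`D_i = δ(u_i) − α⁻¹·δ(v_i)` and an integer Lucas pair `(A, B)`: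
if (P1′) `v_{j+1} = A_n • u_j + B_n • v_j` (`K_j`-rational) and (P2′) `Σ_{i<p} γ^{p^j i} • u_{j+1} =
A_{n+1} • u_j + B_{n+1} • v_j`, then `Σ_{i<p} conj_{γ^{p^j i}} D_{j+1} = α^{n+1} · D_j`
(`A_{n+1} − βA_n = α^{n+1}`, `B_{n+1} − βB_n = −α^n`, `β = p·α⁻¹`).
[cite: CastellaGrossiLeeSkinner2022, Rem. 4.1.4 («the points α^{-k}P[p^k]_α are norm-compatible»)] [cite: PerrinRiou1987BSMF, §3.3 Prop. 3] -/
theorem sum_conjPi_kummerDiff_eq_unitRoot_pow_succ_smul (hord : IsOrdinaryAt W p) (hγ : κ.IsTopGenerator γ)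
    (A B : ℕ → ℤ) (hA0 : A 0 = 1) (hA1 : A 1 = W.frobeniusTrace p)
    (hA : ∀ m, A (m + 2) = W.frobeniusTrace p * A (m + 1) - p * A m)
    (hB0 : B 0 = 0) (hB1 : B 1 = -1) (hB : ∀ m, B (m + 2) = W.frobeniusTrace p * B (m + 1) - p * B m)
    {j ℓ n : ℕ} (hjℓ : κ.layerSubgroup ℓ ≤ κ.layerSubgroup j)
    (hv1 : C.v (j + 1) = A n • C.u j + B n • C.v j)
    (hvfix : ∀ σ ∈ κ.layerSubgroup j, σ • C.v (j + 1) = C.v (j + 1))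
    (hnorm : ∑ i ∈ Finset.range p, (γ ^ (p ^ j * i)) • C.u (j + 1) = A (n + 1) • C.u j + B (n + 1) • C.v j)
    {hu' : ∀ σ ∈ κ.layerSubgroup ℓ, σ • C.u (j + 1) = C.u (j + 1)}
    {hv' : ∀ σ ∈ κ.layerSubgroup ℓ, σ • C.v (j + 1) = C.v (j + 1)}
    {hu : ∀ σ ∈ κ.layerSubgroup ℓ, σ • C.u j = C.u j} {hv : ∀ σ ∈ κ.layerSubgroup ℓ, σ • C.v j = C.v j}
    {du' dv' du dv : (W.baseChange K).torsionH1Pi p (κ.layerSubgroup ℓ)}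
    (hdu' : (W.baseChange K).IsKummerFamilyOver p (κ.layerSubgroup ℓ) hu' du')
    (hdv' : (W.baseChange K).IsKummerFamilyOver p (κ.layerSubgroup ℓ) hv' dv')
    (hdu : (W.baseChange K).IsKummerFamilyOver p (κ.layerSubgroup ℓ) hu du)
    (hdv : (W.baseChange K).IsKummerFamilyOver p (κ.layerSubgroup ℓ) hv dv) :
    ∑ i ∈ Finset.range p, (W.baseChange K).conjPi p (κ.layerSubgroup ℓ) (γ ^ (p ^ j * i))
        (du' - (W.baseChange K).padicPi p (κ.layerSubgroup ℓ) (Ring.inverse (unitRoot W p)) dv') =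
      (W.baseChange K).padicPi p (κ.layerSubgroup ℓ) (unitRoot W p ^ (n + 1))
        (du - (W.baseChange K).padicPi p (κ.layerSubgroup ℓ) (Ring.inverse (unitRoot W p)) dv) := by
  have hunit : IsUnit (unitRoot W p) := (unitRoot_spec_holds W p hord).2
  have hab := unitRoot_add_ringInverse_mul W p hord
  have hαβ := unitRoot_mul_ringInverse_mul W p hord
  have hAα := int_lucas_succ_sub_mul_eq_pow hab hαβ A hA0 hA1 hA n
  have hBα := int_lucas_succ_sub_mul_eq_neg_pow hab hαβ B hB0 hB1 hB n
  have h1 : ((A (n + 1) : ℤ) : ℤ_[p]) - Ring.inverse (unitRoot W p) * ((p : ℤ) : ℤ_[p]) * (A n : ℤ) =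
      unitRoot W p ^ (n + 1) := by
    rw [Int.cast_natCast, ← hAα]
  have h2 : ((B (n + 1) : ℤ) : ℤ_[p]) - Ring.inverse (unitRoot W p) * ((p : ℤ) : ℤ_[p]) * (B n : ℤ) =
      -(unitRoot W p ^ (n + 1) * Ring.inverse (unitRoot W p)) := by
    rw [Int.cast_natCast, pow_succ, mul_assoc (unitRoot W p ^ n), Ring.mul_inverse_cancel _ hunit, mul_one,
      ← hBα, mul_assoc]
  rw [sum_conjPi_sub, sum_conjPi_padicPi, sum_conjPi_kummer_u_succ_eq_lucas C hnorm hdu' hdu hdv,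
    sum_conjPi_kummer_v_succ_eq_lucas C hγ hjℓ hv1 hvfix hdv' hdu hdv, zsmul_add_zsmul_sub_padicPi_zsmul,
    h1, h2, padicPi_neg_left, map_sub, padicPi_padicPi, sub_eq_add_neg]

end Descent

/-! ## §3 `D_j ∈ ℤ_p[Gal(K_k/K)]·κ_k` for `δ < j ≤ k` at arbitrary jumps -/

section Membership

variable {N : ℕ} [NeZero N] {W : WeierstrassCurve ℚ} [W.IsGloballyMinimal] [W.IsElliptic] {K : Type u}
  [Field K] [NumberField K] {p : ℕ} [Fact p.Prime] {κ : ZpExtension K p} (γ : Field.absoluteGaloisGroup K)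
  {jbar : AlgebraicClosure K →+* ℂ} (C : StabilizedHeegnerData N W K κ jbar)

/-- **`D_j ∈ ℤ_p[Gal(K_k/K)]·κ_k` for `δ < j ≤ k`** (Kummer families over `K_k`), under the generalised
identities (P1′)/(P1″)/(P2′) with jumps `ns j` and an integer Lucas pair: downward induction from
`D_k = α^{d(k)}·κ_k`, dividing by the units `α^{ns j + 1}`.
[cite: CastellaGrossiLeeSkinner2022, Rem. 4.1.4 (κ_∞ = lim← κ_k; κ_k norm-compatible)] -/
theorem kummerDiff_mem_stabilizedModuleLayer_lucas (hord : IsOrdinaryAt W p) (hγ : κ.IsTopGenerator γ)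
    (A B : ℕ → ℤ) (hA0 : A 0 = 1) (hA1 : A 1 = W.frobeniusTrace p)
    (hA : ∀ m, A (m + 2) = W.frobeniusTrace p * A (m + 1) - p * A m)
    (hB0 : B 0 = 0) (hB1 : B 1 = -1) (hB : ∀ m, B (m + 2) = W.frobeniusTrace p * B (m + 1) - p * B m)
    (ns : ℕ → ℕ) (hv1 : ∀ j, C.depth < j → C.v (j + 1) = A (ns j) • C.u j + B (ns j) • C.v j)
    (hvfix : ∀ j, C.depth < j → ∀ σ ∈ κ.layerSubgroup j, σ • C.v (j + 1) = C.v (j + 1))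
    (hnorm : ∀ j, C.depth < j →
      ∑ i ∈ Finset.range p, (γ ^ (p ^ j * i)) • C.u (j + 1) = A (ns j + 1) • C.u j + B (ns j + 1) • C.v j)
    {k : ℕ} (hk : C.depth < k) :
    ∀ (n j : ℕ), C.depth < j → j + n = k →
      ∀ {hu : ∀ σ ∈ κ.layerSubgroup k, σ • C.u j = C.u j} {hv : ∀ σ ∈ κ.layerSubgroup k, σ • C.v j = C.v j}
        {du dv : (W.baseChange K).torsionH1Pi p (κ.layerSubgroup k)},
        (W.baseChange K).IsKummerFamilyOver p (κ.layerSubgroup k) hu du →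
        (W.baseChange K).IsKummerFamilyOver p (κ.layerSubgroup k) hv dv →
        du - (W.baseChange K).padicPi p (κ.layerSubgroup k) (Ring.inverse (unitRoot W p)) dv ∈
          stabilizedModuleLayer γ C k hk := by
  have hunit : IsUnit (unitRoot W p) := (unitRoot_spec_holds W p hord).2
  intro n
  induction n with
  | zero =>
    intro j hj hjk hu hv du dv hdu hdv
    obtain rfl : j = k := by simpa using hjk
    have hx : (W.baseChange K).padicPi p (κ.layerSubgroup j) (Ring.inverse (unitRoot W p) ^ C.d j)
        (du - (W.baseChange K).padicPi p (κ.layerSubgroup j) (Ring.inverse (unitRoot W p)) dv) ∈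
          stabilizedClassLayer C j hk :=
      ⟨du, dv, hdu, hdv, rfl⟩
    have hm := padicPi_mem_stabilizedModuleLayer γ C j hk (unitRoot W p ^ C.d j)
      (mem_stabilizedModuleLayer_of_mem_stabilizedClassLayer γ C j hk hx)
    rwa [padicPi_padicPi, unitRoot_pow_mul_ringInverse_pow W p hord, padicPi_one] at hm
  | succ n ih =>
    intro j hj hjk hu hv du dv hdu hdv
    have hj' : C.depth < j + 1 := Nat.lt_succ_of_lt hj
    have hjk' : j + 1 + n = k := by omega
    have hjk_le : j + 1 ≤ k := by omega
    have hkj : κ.layerSubgroup k ≤ κ.layerSubgroup j := κ.layerSubgroup_antitone (by omega)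
    have hu' : ∀ σ ∈ κ.layerSubgroup k, σ • C.u (j + 1) = C.u (j + 1) :=
      fun σ hσ ↦ C.smul_u_eq hj' (κ.layerSubgroup_antitone hjk_le hσ)
    have hv' : ∀ σ ∈ κ.layerSubgroup k, σ • C.v (j + 1) = C.v (j + 1) :=
      fun σ hσ ↦ C.smul_v_eq hj' (κ.layerSubgroup_antitone hjk_le hσ)
    obtain ⟨du', hdu'⟩ := exists_isKummerFamilyOver (W.baseChange K) p (κ.layerSubgroup k) _ hu'
    obtain ⟨dv', hdv'⟩ := exists_isKummerFamilyOver (W.baseChange K) p (κ.layerSubgroup k) _ hv'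
    have hD' := ih (j + 1) hj' hjk' hdu' hdv'
    have hstep := sum_conjPi_kummerDiff_eq_unitRoot_pow_succ_smul C hord hγ A B hA0 hA1 hA hB0 hB1 hB hkj
      (hv1 j hj) (hvfix j hj) (hnorm j hj) hdu' hdv' hdu hdv
    have hmem := sum_conjPi_pow_mem_stabilizedModuleLayer γ C k hk (Finset.range p) (fun i ↦ p ^ j * i) hD'
    rw [hstep] at hmem
    exact mem_stabilizedModuleLayer_of_padicPi_mem γ C k hk (hunit.pow _) hmem

/-- **`D_j ∈ ℤ_p[Gal(K_k/K)]·κ_k`**, packaged (`δ < j ≤ k`), at arbitrary jumps.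
[cite: CastellaGrossiLeeSkinner2022, Rem. 4.1.4] -/
theorem kummerDiff_mem_stabilizedModuleLayer_lucas_of_le (hord : IsOrdinaryAt W p) (hγ : κ.IsTopGenerator γ)
    (A B : ℕ → ℤ) (hA0 : A 0 = 1) (hA1 : A 1 = W.frobeniusTrace p)
    (hA : ∀ m, A (m + 2) = W.frobeniusTrace p * A (m + 1) - p * A m)
    (hB0 : B 0 = 0) (hB1 : B 1 = -1) (hB : ∀ m, B (m + 2) = W.frobeniusTrace p * B (m + 1) - p * B m)
    (ns : ℕ → ℕ) (hv1 : ∀ j, C.depth < j → C.v (j + 1) = A (ns j) • C.u j + B (ns j) • C.v j)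
    (hvfix : ∀ j, C.depth < j → ∀ σ ∈ κ.layerSubgroup j, σ • C.v (j + 1) = C.v (j + 1))
    (hnorm : ∀ j, C.depth < j →
      ∑ i ∈ Finset.range p, (γ ^ (p ^ j * i)) • C.u (j + 1) = A (ns j + 1) • C.u j + B (ns j + 1) • C.v j)
    {k j : ℕ} (hk : C.depth < k) (hj : C.depth < j) (hjk : j ≤ k)
    {hu : ∀ σ ∈ κ.layerSubgroup k, σ • C.u j = C.u j} {hv : ∀ σ ∈ κ.layerSubgroup k, σ • C.v j = C.v j}
    {du dv : (W.baseChange K).torsionH1Pi p (κ.layerSubgroup k)}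
    (hdu : (W.baseChange K).IsKummerFamilyOver p (κ.layerSubgroup k) hu du)
    (hdv : (W.baseChange K).IsKummerFamilyOver p (κ.layerSubgroup k) hv dv) :
    du - (W.baseChange K).padicPi p (κ.layerSubgroup k) (Ring.inverse (unitRoot W p)) dv ∈
      stabilizedModuleLayer γ C k hk :=
  kummerDiff_mem_stabilizedModuleLayer_lucas γ C hord hγ A B hA0 hA1 hA hB0 hB1 hB ns hv1 hvfix hnorm hk
    (k - j) j hj (by omega) hdu hdv

end Membership

/-! ## §4 The iterated descent at arbitrary jumps -/

section Iterated

variable {N : ℕ} [NeZero N] {W : WeierstrassCurve ℚ} [W.IsGloballyMinimal] [W.IsElliptic] {K : Type u}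
  [Field K] [NumberField K] {p : ℕ} [Fact p.Prime] {κ : ZpExtension K p} {γ : Field.absoluteGaloisGroup K}
  {jbar : AlgebraicClosure K →+* ℂ} (C : StabilizedHeegnerData N W K κ jbar)

/-- **ITERATED DESCENT at arbitrary jumps**: over a layer `K_ℓ` with `k + n ≤ ℓ`, `k > δ`:
`Σ_{i<pⁿ} conj_{γ^{p^k i}} D_{k+n} = α^m · D_k` for some `m` — the norm compatibility of CGLS's classes up
to a unit, from (P1′)/(P1″)/(P2′). [cite: CastellaGrossiLeeSkinner2022, Rem. 4.1.4 (κ_∞ := lim← κ_k)]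
[cite: PerrinRiou1987BSMF, §3.3 Prop. 3, Cor. 5] -/
theorem exists_sum_conjPi_kummerDiff_eq_unitRoot_pow_smul (hord : IsOrdinaryAt W p) (hγ : κ.IsTopGenerator γ)
    (A B : ℕ → ℤ) (hA0 : A 0 = 1) (hA1 : A 1 = W.frobeniusTrace p)
    (hA : ∀ m, A (m + 2) = W.frobeniusTrace p * A (m + 1) - p * A m)
    (hB0 : B 0 = 0) (hB1 : B 1 = -1) (hB : ∀ m, B (m + 2) = W.frobeniusTrace p * B (m + 1) - p * B m)
    (ns : ℕ → ℕ) (hv1 : ∀ j, C.depth < j → C.v (j + 1) = A (ns j) • C.u j + B (ns j) • C.v j)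
    (hvfix : ∀ j, C.depth < j → ∀ σ ∈ κ.layerSubgroup j, σ • C.v (j + 1) = C.v (j + 1))
    (hnorm : ∀ j, C.depth < j →
      ∑ i ∈ Finset.range p, (γ ^ (p ^ j * i)) • C.u (j + 1) = A (ns j + 1) • C.u j + B (ns j + 1) • C.v j)
    {ℓ : ℕ} :
    ∀ (n k : ℕ), C.depth < k → k + n ≤ ℓ →
      ∀ {hun : ∀ σ ∈ κ.layerSubgroup ℓ, σ • C.u (k + n) = C.u (k + n)}
        {hvn : ∀ σ ∈ κ.layerSubgroup ℓ, σ • C.v (k + n) = C.v (k + n)}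
        {hu : ∀ σ ∈ κ.layerSubgroup ℓ, σ • C.u k = C.u k} {hv : ∀ σ ∈ κ.layerSubgroup ℓ, σ • C.v k = C.v k}
        {dun dvn du dv : (W.baseChange K).torsionH1Pi p (κ.layerSubgroup ℓ)},
        (W.baseChange K).IsKummerFamilyOver p (κ.layerSubgroup ℓ) hun dun →
        (W.baseChange K).IsKummerFamilyOver p (κ.layerSubgroup ℓ) hvn dvn →
        (W.baseChange K).IsKummerFamilyOver p (κ.layerSubgroup ℓ) hu du →
        (W.baseChange K).IsKummerFamilyOver p (κ.layerSubgroup ℓ) hv dv →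
        ∃ m : ℕ, ∑ i ∈ Finset.range (p ^ n), (W.baseChange K).conjPi p (κ.layerSubgroup ℓ) (γ ^ (p ^ k * i))
            (dun - (W.baseChange K).padicPi p (κ.layerSubgroup ℓ) (Ring.inverse (unitRoot W p)) dvn) =
          (W.baseChange K).padicPi p (κ.layerSubgroup ℓ) (unitRoot W p ^ m)
            (du - (W.baseChange K).padicPi p (κ.layerSubgroup ℓ) (Ring.inverse (unitRoot W p)) dv) := by
  intro n
  induction n with
  | zero =>
    intro k hk hkℓ hun hvn hu hv dun dvn du dv hdun hdvn hdu hdv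
    have h1 : dun = du := IsKummerFamilyOver.unique p hdun hdu
    have h2 : dvn = dv := IsKummerFamilyOver.unique p hdvn hdv
    refine ⟨0, ?_⟩
    rw [pow_zero, Finset.sum_range_one, mul_zero, pow_zero, conjPi_one, pow_zero, padicPi_one, h1, h2]
  | succ n ih =>
    intro k hk hkℓ hun hvn hu hv dun dvn du dv hdun hdvn hdu hdv
    have hkn : C.depth < k + n := by omega
    have hun' : ∀ σ ∈ κ.layerSubgroup ℓ, σ • C.u (k + n) = C.u (k + n) :=
      fun σ hσ ↦ C.smul_u_eq hkn (κ.layerSubgroup_antitone (by omega) hσ)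
    have hvn' : ∀ σ ∈ κ.layerSubgroup ℓ, σ • C.v (k + n) = C.v (k + n) :=
      fun σ hσ ↦ C.smul_v_eq hkn (κ.layerSubgroup_antitone (by omega) hσ)
    obtain ⟨dun', hdun'⟩ := exists_isKummerFamilyOver (W.baseChange K) p (κ.layerSubgroup ℓ) _ hun'
    obtain ⟨dvn', hdvn'⟩ := exists_isKummerFamilyOver (W.baseChange K) p (κ.layerSubgroup ℓ) _ hvn'
    have hℓ : κ.layerSubgroup ℓ ≤ κ.layerSubgroup (k + n) := κ.layerSubgroup_antitone (by omega)
    have hstep := sum_conjPi_kummerDiff_eq_unitRoot_pow_succ_smul C hord hγ A B hA0 hA1 hA hB0 hB1 hB hℓ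
      (hv1 (k + n) hkn) (hvfix (k + n) hkn) (hnorm (k + n) hkn) hdun hdvn hdun' hdvn'
    obtain ⟨m, hm⟩ := ih k hk (by omega) hdun' hdvn' hdu hdv
    refine ⟨ns (k + n) + 1 + m, ?_⟩
    rw [pow_succ p n, (W.baseChange K).sum_range_mul_conjPi_pow p _ γ (p ^ n) p (p ^ k)]
    have hexp : ∀ j, p ^ k * p ^ n * j = p ^ (k + n) * j := fun j ↦ by rw [← pow_add]
    simp_rw [hexp]
    rw [hstep, sum_conjPi_padicPi, hm, padicPi_padicPi, ← pow_add]

end Iterated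

end Literature.NumberTheory.EllipticCurves

end
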